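import Mathlib.Data.Rat.Defs
import Summits.NavierStokesRegularity.TurbBounds.Certs.S1000.EvalPieces10p4
import HarnessLib

/-!
# Row S1000 evaluator — PIECE DATA of mode 10 (part 5): sparse rows of generator A's piece matrices

Pieces of the affine block rule `Q_m(φ̂,T) = Q0_m + Σ_p φ̂_p·Qφ_m⁽ᵖ⁾ + T·QT_m (rbsdp SPEC 2.8)`, mode m = 10 (dim 90), from `C1p-fw16-Gx2-Gr1000-P20-N16-j110919/blocks_A.rbsdp-blocks0.json.gz`
(sha256 7e6f3737c61f1cab…; rbcert 15211248adbb023f…): each symmetric piece as per-row column lists (`*_js`) and value lists (`*_vs`), both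
triangles filled, 20 rows per def. LITERAL DATA — that these are the Legendre–Galerkin matrices is certified by generator A/B agreement
(t2-verify §3), NOT by the kernel. Generated by pub-turb-shear gen 5 `gen_eval2.py`. HONEST FRAMING: rigorous bounds for the stated PDE and boundary conditions; no claim about physical turbulence beyond the bound.
-/

set_option linter.style.longLine false

namespace Summit.NavierStokesRegularity.TurbBounds.Certs.S1000.Eval

/-- mode 10, piece `Qphi20`: value lists of rows 80–89 -/
def Qphi20_10_vs4 : List (List ℚ) := [[(8414461811008000/492504601212196158065361), ((-90579206553792)/2691281973837137475767), (729730488598848/36172654326319491835309), ((-458782838411023104)/168600741814975151444375249), ((-4204826034319565120)/21749495694131794536324407121), ((-372768982695221440)/1828669584300884334896685393)], [(328164010629312/23452600057723626574541), ((-8522409906647616)/304883800750407145469033), (408560621434918656/24085820259282164492053607), ((-3509974941996633088)/1517406676334776362999377241), ((-346112258584341722560)/2106906310712223973445287846779), ((-27817670126795529522880)/156181183186385628390521209359951)], [(1902568311727488/164168200404065386021787), ((-564553871133424896)/24085820259282164492053607), (21821204510721715264/1517406676334776362999377241), ((-2918914829727437126080)/1601804408234016248316060913179), ((-71289691361217112960)/156755955021464330937291277377)],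 [(17960871222645504/1852755404560166499388739), ((-477459826668659648)/24085820259282164492053607), (35974128319690390720/2928947770599684607649960721), ((-85001921489624360096384)/54185308452419503727323684879983), ((-1052597187285778843754240)/2655080114168555682638860559119167)], [(954919653337319296/116723590487290489461490557), ((-6383390920580668118080)/377834262407359314386844933009), (13112829456790241500352/1202598748126761939695719794033), ((-142749514081612198349056)/69666825153110790506559023417121)], [(1070168577015961280/153778698578493819449265337), ((-2388013077974398398784)/164696986177566880630163175927), (73028117812669572676864/7740758350345643389617669268569), ((-16529753653165986468352)/9251150223583817709543068150241)], [(981986686269846070528/164696986177566880630163175927), ((-449286961475166199424)/40499258896123003433646682605), (14732133865402463166592/2831984762321576849860122903135)], [(20654589012451004416/4016999662867484893418614047), ((-485957735768734981737856)/50409328769324067927510187675803), (25047574865329118336/5503802682533471768480203917)], [(26463692172202849408/17024427142628864548297935723), ((-26463692172202849408)/18608094783803642645814022767)], [(3805815262223152256/2771418372055861670653152327), ((-57087228933347283840)/45266500076912407287334821341)]]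
/-- mode 10, piece `Qphi20` — all column lists (sparse rows, both triangles). -/
def Qphi20_10_js : List (List ℕ) := Qphi20_10_js0 ++ Qphi20_10_js1 ++ Qphi20_10_js2 ++ Qphi20_10_js3 ++ Qphi20_10_js4
/-- mode 10, piece `Qphi20` — all value lists. -/
def Qphi20_10_vs : List (List ℚ) := Qphi20_10_vs0 ++ Qphi20_10_vs1 ++ Qphi20_10_vs2 ++ Qphi20_10_vs3 ++ Qphi20_10_vs4
end Summit.NavierStokesRegularity.TurbBounds.Certs.S1000.Eval
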